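import Literature.Analysis.FluidPDE.Tao2016AveragedNS.RetunedFlow
import HarnessLib

/-!
# Tao 2016, §5.5 — SEED CANCELLATION for the retuned family: any firing guarantee costs less than the seed

T. Tao, *Finite time blowup for an averaged three-dimensional Navier–Stokes equation*, J. Amer.
Math. Soc. **29** (2016) 601–674 = arXiv:1402.0290, §5.1 (the pump gate and its explicit
`sech/tanh` solution (pomp)), §5.5 (the five-mode delay circuit (5.5)/(5.6) and Theorem 5.3,
pp. 28–30: the pump of coupling `ε²exp(-K¹⁰)` "transfers a minute amount of energy from `a` to `c`"
— the SEED of the trigger mode). [`Tao2016AveragedNS`]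
E. Hairer, S. P. Nørsett, G. Wanner, *Solving ODE I* (2nd ed. 1993), §I.10 (defect of an
approximate solution; pseudo-orbits). [`HairerNorsettWanner1993`]

HONEST FRAMING (cell pub-fluidc, blueprint seat 1): low prior, high value-of-information
experiment on Tao's machine paradigm; NOT a claim that NS blows up. Everything here is
finite-dimensional ODE theory about Tao's toy circuit (5.5) and its one-parameter retuning
`delayCircuitWith K M ε` (`GateRetuning.lean`; Tao's member is `M = K¹⁰`,
`delayCircuitWith_pow_ten`); nothing is asserted about the Navier–Stokes equations.

## Provenance — this is the seed adversary of `GateFragility.lean`, run against every member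

`GateFragility.lean` (cell gen 6, §A there) constructed the SEED-FREE ORBIT `seedFreeOrbit ε` — the
free pump trajectory `(sech εt, tanh εt, 0, 0, 0)` of §5.1 (pomp), which is what the circuit does
from Tao's datum (5.6) when an external forcing exactly cancels the seed pump `a → c` — and proved,
for Tao's member (5.5), that it is an `ε²e^{-K¹⁰}`-pseudo-orbit that never fires
(`seedFreeOrbit_isPseudoOrbit`, `not_firesOnBudget_of_seed_mul_le`, `shadowRadius_lt_seed_mul`).
This file changes ONE constant: against the member `delayCircuitWith K M ε` the same orbit has
defect exactly `-ε²e^{-M}a²·e_c` (`seedFreeOrbit_defectWith`), so it is an `ε²e^{-M}`-pseudo-orbit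
of every member (`seedFreeOrbit_isPseudoOrbit_with`; at `M = K¹⁰` this is the gen-6 statement,
`seedFreeOrbit_isPseudoOrbit_pow_ten`). Nothing else in §1 is new.

## What this file decides

The cell asked (SPEC-INPUT-bp1.md (D)(4), typed 2026-08-19 as `PseudoOrbitTransition q`): does every
`δ`-pseudo-orbit of a member, issued `δ₀`-close to (5.6), fire by the uniform cycle time `2` as soon
as the forcing budget is POLYNOMIALLY small, `δ₀ + δT ≤ ε²/K^q` for some fixed `q`, UNIFORMLY in the
sharpness `3000·log K ≤ M ≤ K¹⁰`? The typed question overlooked the seed adversary: the budget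
`ε²/K^q` does not see `M`, the seed `ε²e^{-M}` does. ANSWER, kernel-checked: **no, for every `q`**.

* `budget_lt_seed_of_firing_guarantee` — for EVERY member, horizon `T`, radius `R ≥ 1` and
  tolerance `θ < 1`: a forcing budget `B` such that "every pseudo-orbit from (5.6) with
  `δ₀ + δT ≤ B` has `|ã(T) - 1| ≤ θ`" is `< ε²e^{-M}·T` (the time-integrated seed). With the
  proved sufficient budget of `RetunedFlow.lean` this brackets the member's critical budget:
  `shadowRadiusWith ≤ B* < ε²e^{-M}T` (`shadowRadiusWith_lt_seed_budget` — the family version of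
  gen 6's `shadowRadius_lt_seed_mul`, now with Theorem 5.3 of the family PROVED rather than assumed).
* `not_pseudoOrbitTransition`, `not_pseudoOrbitTransitionTimed` — question (D)(4), recorded verbatim
  as `PseudoOrbitTransition q` / `PseudoOrbitTransitionTimed q`, has a negative answer for every
  `q : ℕ` (witness member `M = K¹⁰`, `K = K₀ + q`: `2ε²e^{-K¹⁰} ≤ ε²/K^q`); for `q ≤ 2999` EVERY
  member is a witness (`exists_dud_below_poly_budget_all_members`: `2K^q ≤ K³⁰⁰⁰ ≤ e^M`).
* `budget_lt_poly_of_firing_guarantee_log` — on the logarithmic retuning `M = p·log K` the necessary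
  budget over the cycle `[0,2]` reads `< 2ε²/K^p`: a POWER of `K`, one factor `K^p` below the
  trigger's natural scale `ε²`, and `K^{p-10}·2` above the proved one-sided kick tolerance
  `kickToleranceWith = ε²e^{-M}K¹⁰` (`TriggerToleranceWith.lean`).

READING (cell DICTIONARY §21). The correctly scaled form of (D)(4) must carry a budget at the SEED
scale, `δ₀ + δT ≤ ε²e^{-M}/K^q` (cell folder `SPEC-D4` v2; not decided here): the direction `-c`
(cancel the seed during the arming phase) is where the gate is genuinely — not by Grönwall — fragile,
exactly as gen 6 said for Tao's member; the retuning makes that scale polynomial, it does not remove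
it. No facts, no axioms, no `sorry`; the only definitions are the two recorded (and refuted)
statements of question (D)(4).
-/

namespace Literature.Analysis.FluidPDE.Tao2016AveragedNS

open Set Metric
open scoped NNReal

/-! ## §1. The seed-free orbit of `GateFragility.lean` against every member of the family -/

/-- The seed-free orbit stays on the unit energy sphere (`a² + b² = 1`, `c = d = ã = 0`).
[cite: Tao2016AveragedNS, §5.5 (energy-con)] -/
theorem energy_seedFreeOrbit (ε t : ℝ) : energy (seedFreeOrbit ε t) = 1 := by
  rw [energy, Fin.sum_univ_five, seedFreeOrbit_c, seedFreeOrbit_d, seedFreeOrbit_output]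
  linear_combination seedFreeOrbit_sq_add_sq ε t

/-- The member `delayCircuitWith K M ε` evaluated along the seed-free orbit: the free pump field
plus the member's seed term `ε²e^{-M}a²` in the `c`-slot (at `M = K¹⁰`: `delayCircuit_seedFreeOrbit`).
Neither `K` nor the amplifier coupling `ε⁻¹M` enters: their inputs `c, d` vanish along the orbit.
[cite: Tao2016AveragedNS, §5.5 (5.5)] -/
theorem delayCircuitWith_seedFreeOrbit (K M ε t : ℝ) :
    delayCircuitWith K M ε (seedFreeOrbit ε t) =
      ![-(ε * seedFreeOrbit ε t 0 * seedFreeOrbit ε t 1), ε * seedFreeOrbit ε t 0 ^ 2,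
        ε ^ 2 * Real.exp (-M) * seedFreeOrbit ε t 0 ^ 2, 0, 0] := by
  ext i
  fin_cases i <;> simp [delayCircuitWith, seedFreeOrbit]

/-- THE DEFECT of the seed-free orbit with respect to the member: velocity minus field is
`-ε²e^{-M}a²` in the `c`-slot and zero elsewhere — the forcing that cancels the member's seed
(at `M = K¹⁰`: `seedFreeOrbit_defect`). [cite: Tao2016AveragedNS, §5.5 (5.5)] -/
theorem seedFreeOrbit_defectWith (K M ε t : ℝ) :
    ![-(ε * seedFreeOrbit ε t 0 * seedFreeOrbit ε t 1), ε * seedFreeOrbit ε t 0 ^ 2, (0 : ℝ), 0, 0]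
        - delayCircuitWith K M ε (seedFreeOrbit ε t) =
      ![0, 0, -(ε ^ 2 * Real.exp (-M) * seedFreeOrbit ε t 0 ^ 2), 0, 0] := by
  rw [delayCircuitWith_seedFreeOrbit]
  ext i
  fin_cases i <;> simp

/-- The defect has sup-size at most the member's seed rate `ε²e^{-M}` (as `a² ≤ 1`)
(at `M = K¹⁰`: `norm_seedFreeOrbit_defect_le`). [cite: Tao2016AveragedNS, §5.5 (5.5)] -/
theorem norm_seedFreeOrbit_defectWith_le (K M ε t : ℝ) :
    ‖![-(ε * seedFreeOrbit ε t 0 * seedFreeOrbit ε t 1), ε * seedFreeOrbit ε t 0 ^ 2, (0 : ℝ), 0, 0]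
        - delayCircuitWith K M ε (seedFreeOrbit ε t)‖ ≤ ε ^ 2 * Real.exp (-M) := by
  rw [seedFreeOrbit_defectWith]
  have hs : 0 ≤ ε ^ 2 * Real.exp (-M) := by positivity
  have hx : seedFreeOrbit ε t 0 ^ 2 ≤ 1 := by
    nlinarith [seedFreeOrbit_sq_add_sq ε t, sq_nonneg (seedFreeOrbit ε t 1)]
  have hkey : |-(ε ^ 2 * Real.exp (-M) * seedFreeOrbit ε t 0 ^ 2)| ≤ ε ^ 2 * Real.exp (-M) := by
    rw [abs_neg, abs_of_nonneg (by positivity)]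
    exact mul_le_of_le_one_right hs hx
  refine (pi_norm_le_iff_of_nonneg hs).2 fun i => ?_
  rw [Real.norm_eq_abs]
  fin_cases i
  · simpa using hs
  · simpa using hs
  · simpa using hkey
  · simpa using hs
  · simpa using hs

/-- **The seed-free orbit is an `ε²e^{-M}`-pseudo-orbit of every member** `delayCircuitWith K M ε`,
on every window `[0,T]`, in every sup-ball of radius `R ≥ 1`, issued exactly from (5.6) — the seed
adversary of `GateFragility.lean` with the member's seed in place of `ε²e^{-K¹⁰}`.
[cite: HairerNorsettWanner1993, §I.10] -/
theorem seedFreeOrbit_isPseudoOrbit_with (K M ε T : ℝ) {R : ℝ≥0} (hR : 1 ≤ R) :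
    IsPseudoOrbit (delayCircuitWith K M ε) (ε ^ 2 * Real.exp (-M)) R T (seedFreeOrbit ε) where
  continuousOn := fun t _ => (hasDerivAt_seedFreeOrbit ε t).continuousAt.continuousWithinAt
  defect := fun t _ =>
    ⟨_, (hasDerivAt_seedFreeOrbit ε t).hasDerivWithinAt, norm_seedFreeOrbit_defectWith_le K M ε t⟩
  norm_le := fun t _ => (seedFreeOrbit_norm_le ε t).trans (by exact_mod_cast hR)

/-- At `M = K¹⁰` the statement is `GateFragility.seedFreeOrbit_isPseudoOrbit` (nothing forks).
[cite: HairerNorsettWanner1993, §I.10] -/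
theorem seedFreeOrbit_isPseudoOrbit_pow_ten (K ε T : ℝ) {R : ℝ≥0} (hR : 1 ≤ R) :
    IsPseudoOrbit (delayCircuitWith K (K ^ 10) ε) (ε ^ 2 * Real.exp (-K ^ 10)) R T
      (seedFreeOrbit ε) := by
  rw [delayCircuitWith_pow_ten]
  exact seedFreeOrbit_isPseudoOrbit K ε T hR

/-! ## §2. The number: any firing guarantee costs less than the integrated seed -/

/-- **A dud inside any budget at or above the integrated seed.** If `ε²e^{-M}·T ≤ B` then some
pseudo-orbit of the member on `[0,T]`, issued EXACTLY at Tao's datum (5.6), with forcing budget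
`δ·T ≤ B`, of energy one throughout, keeps its trigger, rotor and output modes identically zero.
[cite: Tao2016AveragedNS, §5.5 (5.5)–(5.6)] -/
theorem exists_dud_of_seed_budget_le {K M ε T B : ℝ} {R : ℝ≥0} (hR : 1 ≤ R)
    (hB : ε ^ 2 * Real.exp (-M) * T ≤ B) :
    ∃ (Y : ℝ → Fin 5 → ℝ) (δ : ℝ), 0 ≤ δ ∧ IsPseudoOrbit (delayCircuitWith K M ε) δ R T Y ∧
      Y 0 = delayInit ∧ δ * T ≤ B ∧ (∀ t, energy (Y t) = 1) ∧
      ∀ t, Y t 2 = 0 ∧ Y t 3 = 0 ∧ Y t 4 = 0 :=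
  ⟨seedFreeOrbit ε, ε ^ 2 * Real.exp (-M), by positivity, seedFreeOrbit_isPseudoOrbit_with K M ε T hR,
    seedFreeOrbit_zero ε, hB, energy_seedFreeOrbit ε, fun t =>
      ⟨seedFreeOrbit_c ε t, seedFreeOrbit_d ε t, seedFreeOrbit_output ε t⟩⟩

/-- **THE NUMBER (necessary side).** Fix a member `delayCircuitWith K M ε`, a horizon `T`, a radius
`R ≥ 1` and an output tolerance `θ < 1`. If a forcing budget `B` GUARANTEES loading — every
`δ`-pseudo-orbit in the `R`-ball on `[0,T]` issued `δ₀`-close to (5.6) with `δ₀ + δT ≤ B` has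
`|ã(T) - 1| ≤ θ` — then `B < ε²e^{-M}·T`: the guarantee's budget is below the time-integrated SEED of
the member. No hypothesis on `K`, `M`, `ε` is needed (family version of gen 6's
`not_firesOnBudget_of_seed_mul_le`). [cite: Tao2016AveragedNS, §5.5 Theorem 5.3] -/
theorem budget_lt_seed_of_firing_guarantee {K M ε T B θ : ℝ} {R : ℝ≥0} (hR : 1 ≤ R) (hθ : θ < 1)
    (h : ∀ (Y : ℝ → Fin 5 → ℝ) (δ δ₀ : ℝ), 0 ≤ δ → 0 ≤ δ₀ →
      IsPseudoOrbit (delayCircuitWith K M ε) δ R T Y → ‖Y 0 - delayInit‖ ≤ δ₀ →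
      δ₀ + δ * T ≤ B → |Y T 4 - 1| ≤ θ) :
    B < ε ^ 2 * Real.exp (-M) * T := by
  by_contra hle
  rw [not_lt] at hle
  have hfire := h (seedFreeOrbit ε) (ε ^ 2 * Real.exp (-M)) 0 (by positivity) le_rfl
    (seedFreeOrbit_isPseudoOrbit_with K M ε T hR)
    (by rw [seedFreeOrbit_zero, sub_self, norm_zero]) (by simpa using hle)
  rw [seedFreeOrbit_output] at hfire
  norm_num at hfire
  linarith

/-- **The bracket.** Under the standing hypotheses of the family's Theorem 5.3 and for `T ≥ 2`,
`θ ≤ 1/4`: the PROVED sufficient budget `shadowRadiusWith K M ε R T θ` of the shadowing theorem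
(`IsPseudoOrbit.fires_from_two_of_le_shadowRadiusWith`, `RetunedFlow.lean`) is strictly below the
integrated seed `ε²e^{-M}T` — shown not by estimating the Grönwall exponent but by exhibiting the
dud (family version of gen 6's `shadowRadius_lt_seed_mul`, with the family's Theorem 5.3 now a
theorem rather than a hypothesis). The member's critical forcing budget lies in
`[shadowRadiusWith, ε²e^{-M}T)`. [cite: Tao2016AveragedNS, §5.5 Theorem 5.3] -/
theorem shadowRadiusWith_lt_seed_budget {K M ε T θ : ℝ} {R : ℝ≥0} (hR : 1 ≤ R)
    (hK : 2 * 20 ^ 42 * (Nat.factorial 42 : ℝ) + 16 ≤ K) (hML : 3000 * Real.log K ≤ M)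
    (hMK : M ≤ K ^ 10) (hε : 0 < ε) (hεle : ε ≤ Real.exp (-(10 * M)) / K ^ 100)
    (hT : 2 ≤ T) (hθ : θ ≤ 1 / 4) :
    shadowRadiusWith K M ε R T θ < ε ^ 2 * Real.exp (-M) * T := by
  have hB : (0 : ℝ) ≤ 2 * 20 ^ 42 * (Nat.factorial 42 : ℝ) := by positivity
  have hK16 : (16 : ℝ) ≤ K := by linarith
  have hK10 : (16 : ℝ) ^ 10 ≤ K ^ 10 := pow_le_pow_left₀ (by norm_num) hK16 10
  have h200 : 200 / K ^ 10 ≤ (1 : ℝ) / 4 := by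
    rw [div_le_div_iff₀ (by positivity) (by norm_num)]
    nlinarith
  refine budget_lt_seed_of_firing_guarantee (K := K) (θ := 200 / K ^ 10 + θ) hR (by linarith) ?_
  intro Y δ δ₀ hδ hδ₀ hY h0 hbud
  have hkick : ‖Y 0 - kickInit 0‖ ≤ δ₀ := by rw [kickInit_zero]; exact h0
  exact (hY.fires_from_two_of_le_shadowRadiusWith hR hK hML hMK hε hεle le_rfl
    (kickToleranceWith_pos (by linarith) hε).le hkick hδ hbud hT le_rfl).1

/-! ## §3. The cell's question (D)(4) as typed on 2026-08-19, and its negative answer for every `q` -/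

/-- **Cell question (D)(4), exponent `q`** (pub-fluidc SPEC-INPUT-bp1.md (D)(4), typed verbatim in
the cell folder as `SPEC-D4-PseudoOrbitTransition.lean`, 2026-08-19): every `δ`-pseudo-orbit `Y` of
a member `delayCircuitWith K M ε` (standing hypotheses of the family's Theorem 5.3) in the sup-ball
of radius `2` on `[0,T]`, `T ≥ 2`, issued `δ₀`-close to Tao's datum `delayInit`, with budget
`δ₀ + δ·T ≤ ε²/K^q`, has fired with tolerance `1/4` at every time in `[2,T]`. DECIDED BELOW:
false for every `q` (`not_pseudoOrbitTransition`). [cite: Tao2016AveragedNS, Theorem 5.3] -/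
def PseudoOrbitTransition (q : ℕ) : Prop :=
  ∀ (K M ε δ δ₀ T : ℝ) (Y : ℝ → Fin 5 → ℝ),
    2 * 20 ^ 42 * (Nat.factorial 42 : ℝ) + 16 ≤ K → 3000 * Real.log K ≤ M → M ≤ K ^ 10 →
    0 < ε → ε ≤ Real.exp (-(10 * M)) / K ^ 100 → 2 ≤ T → 0 ≤ δ₀ → 0 ≤ δ →
    IsPseudoOrbit (delayCircuitWith K M ε) δ 2 T Y → ‖Y 0 - delayInit‖ ≤ δ₀ →
    δ₀ + δ * T ≤ ε ^ 2 / K ^ q →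
    ∀ t ∈ Icc 2 T, |Y t 4 - 1| ≤ 1 / 4 ∧ ∀ i : Fin 5, i ≠ 4 → |Y t i| ≤ 1 / 4

/-- **Cell question (D)(4), timed form, exponent `q`**: as `PseudoOrbitTransition q`, and moreover
the pseudo-orbit is still quiet (`|ã| ≤ 1/4`) on `[0, √2 - 1/4]`. DECIDED BELOW: false for every `q`.
[cite: Tao2016AveragedNS, Theorem 5.3] -/
def PseudoOrbitTransitionTimed (q : ℕ) : Prop :=
  ∀ (K M ε δ δ₀ T : ℝ) (Y : ℝ → Fin 5 → ℝ),
    2 * 20 ^ 42 * (Nat.factorial 42 : ℝ) + 16 ≤ K → 3000 * Real.log K ≤ M → M ≤ K ^ 10 →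
    0 < ε → ε ≤ Real.exp (-(10 * M)) / K ^ 100 → 2 ≤ T → 0 ≤ δ₀ → 0 ≤ δ →
    IsPseudoOrbit (delayCircuitWith K M ε) δ 2 T Y → ‖Y 0 - delayInit‖ ≤ δ₀ →
    δ₀ + δ * T ≤ ε ^ 2 / K ^ q →
    (∀ t ∈ Icc 0 (Real.sqrt 2 - 1 / 4), |Y t 4| ≤ 1 / 4) ∧
    ∀ t ∈ Icc 2 T, |Y t 4 - 1| ≤ 1 / 4 ∧ ∀ i : Fin 5, i ≠ 4 → |Y t i| ≤ 1 / 4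

/-- The timed form implies the untimed one. [folklore] -/
theorem PseudoOrbitTransitionTimed.untimed {q : ℕ} (h : PseudoOrbitTransitionTimed q) :
    PseudoOrbitTransition q :=
  fun K M ε δ δ₀ T Y hK hML hMK hε hεle hT hδ₀ hδ hY h0 hb =>
    (h K M ε δ δ₀ T Y hK hML hMK hε hεle hT hδ₀ hδ hY h0 hb).2

/-- Monotonicity in the exponent: a larger `q` is a SMALLER budget, hence a weaker demand.
[folklore] -/
theorem PseudoOrbitTransition.mono {q q' : ℕ} (hq : q ≤ q') (h : PseudoOrbitTransition q) :
    PseudoOrbitTransition q' := by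
  intro K M ε δ δ₀ T Y hK hML hMK hε hεle hT hδ₀ hδ hY h0 hb
  refine h K M ε δ δ₀ T Y hK hML hMK hε hεle hT hδ₀ hδ hY h0 (hb.trans ?_)
  have hK1 : (1 : ℝ) ≤ K := by
    have : (0 : ℝ) ≤ 2 * 20 ^ 42 * (Nat.factorial 42 : ℝ) := by positivity
    linarith
  exact div_le_div_of_nonneg_left (sq_nonneg ε) (by positivity) (pow_le_pow_right₀ hK1 hq)

/-- On Tao's member `M = K¹⁰` the doubled seed is below every polynomial budget:
`2·K^q ≤ e^{K¹⁰}` once `K ≥ q + 1`, `K ≥ 1`. [folklore] -/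
theorem two_mul_pow_le_exp_pow_ten {K : ℝ} {q : ℕ} (hK1 : 1 ≤ K) (hKq : (q : ℝ) + 1 ≤ K) :
    2 * K ^ q ≤ Real.exp (K ^ 10) := by
  have hKpos : 0 < K := by linarith
  have hlogK : Real.log K ≤ K := (Real.log_le_sub_one_of_pos hKpos).trans (by linarith)
  have hl2 : Real.log 2 ≤ 1 := by
    have := Real.log_le_sub_one_of_pos (by norm_num : (0 : ℝ) < 2); linarith
  have hq0 : (0 : ℝ) ≤ q := Nat.cast_nonneg q
  have hexp : Real.log 2 + q * Real.log K ≤ K ^ 10 := by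
    have h1 : (q : ℝ) * Real.log K ≤ q * K := by gcongr
    have h2 : (1 : ℝ) + q * K ≤ K ^ 10 :=
      calc (1 : ℝ) + q * K ≤ K + q * K := by linarith
        _ = (q + 1) * K := by ring
        _ ≤ K * K := by gcongr
        _ = K ^ 2 := by ring
        _ ≤ K ^ 10 := pow_le_pow_right₀ hK1 (by norm_num)
    linarith
  calc 2 * K ^ q = Real.exp (Real.log 2 + q * Real.log K) := by
        rw [Real.exp_add, Real.exp_log two_pos, show (q : ℝ) * Real.log K = Real.log K * q by ring,
          ← Real.rpow_def_of_pos hKpos, Real.rpow_natCast]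
    _ ≤ Real.exp (K ^ 10) := Real.exp_le_exp.2 hexp

/-- **Negative answer to the cell's question (D)(4) for every exponent.** Witness: `K = K₀ + q`
(`K₀ = 2·20⁴²·42! + 16`), Tao's member `M = K¹⁰`, `ε = e^{-10M}/K¹⁰⁰`, `T = 2`, `δ₀ = 0`,
`δ = ε²e^{-M}` and the seed-free orbit, whose budget `2ε²e^{-K¹⁰} ≤ ε²/K^q` is admissible and whose
output at time `2` is `0`, not within `1/4` of `1`. [cite: Tao2016AveragedNS, §5.5 Theorem 5.3] -/
theorem not_pseudoOrbitTransition (q : ℕ) : ¬ PseudoOrbitTransition q := by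
  intro h
  set K : ℝ := 2 * 20 ^ 42 * (Nat.factorial 42 : ℝ) + 16 + q with hKdef
  have hB : (0 : ℝ) ≤ 2 * 20 ^ 42 * (Nat.factorial 42 : ℝ) := by positivity
  have hq0 : (0 : ℝ) ≤ q := Nat.cast_nonneg q
  have hK0 : 2 * 20 ^ 42 * (Nat.factorial 42 : ℝ) + 16 ≤ K := by rw [hKdef]; linarith
  have hK1 : (1 : ℝ) ≤ K := by linarith
  have hKpos : (0 : ℝ) < K := by linarith
  have hKq : (q : ℝ) + 1 ≤ K := by rw [hKdef]; linarith
  have hlogK : Real.log K ≤ K := (Real.log_le_sub_one_of_pos hKpos).trans (by linarith)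
  have hbig : (3000 : ℝ) ≤ 2 * 20 ^ 42 * (Nat.factorial 42 : ℝ) :=
    calc (3000 : ℝ) ≤ 2 * 20 ^ 42 := by norm_num
      _ = 2 * 20 ^ 42 * 1 := (mul_one _).symm
      _ ≤ 2 * 20 ^ 42 * (Nat.factorial 42 : ℝ) := by
        gcongr; exact_mod_cast Nat.succ_le_of_lt (Nat.factorial_pos 42)
  have hML : 3000 * Real.log K ≤ K ^ 10 :=
    calc 3000 * Real.log K ≤ 3000 * K := by gcongr
      _ ≤ K * K := by gcongr; linarith
      _ = K ^ 2 := by ring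
      _ ≤ K ^ 10 := pow_le_pow_right₀ hK1 (by norm_num)
  set ε : ℝ := Real.exp (-(10 * K ^ 10)) / K ^ 100 with hεdef
  have hε : 0 < ε := by positivity
  have hKqpos : (0 : ℝ) < K ^ q := pow_pos hKpos q
  have hbud : 0 + ε ^ 2 * Real.exp (-(K ^ 10)) * 2 ≤ ε ^ 2 / K ^ q := by
    have h2 : 2 * Real.exp (-(K ^ 10)) ≤ 1 / K ^ q := by
      rw [Real.exp_neg, le_div_iff₀ hKqpos]
      calc 2 * (Real.exp (K ^ 10))⁻¹ * K ^ q = 2 * K ^ q / Real.exp (K ^ 10) := by ring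
        _ ≤ 1 := by
          rw [div_le_one (Real.exp_pos _)]
          exact two_mul_pow_le_exp_pow_ten hK1 hKq
    calc 0 + ε ^ 2 * Real.exp (-(K ^ 10)) * 2 = ε ^ 2 * (2 * Real.exp (-(K ^ 10))) := by ring
      _ ≤ ε ^ 2 * (1 / K ^ q) := by gcongr
      _ = ε ^ 2 / K ^ q := by ring
  have hfire := h K (K ^ 10) ε (ε ^ 2 * Real.exp (-(K ^ 10))) 0 2 (seedFreeOrbit ε) hK0 hML le_rfl
    hε le_rfl le_rfl le_rfl (by positivity)
    (seedFreeOrbit_isPseudoOrbit_with K (K ^ 10) ε 2 (by norm_num))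
    (by rw [seedFreeOrbit_zero, sub_self, norm_zero]) hbud 2 ⟨le_rfl, le_rfl⟩
  have h4 := hfire.1
  rw [seedFreeOrbit_output] at h4
  norm_num at h4

/-- **Negative answer to the timed form for every exponent.**
[cite: Tao2016AveragedNS, §5.5 Theorem 5.3] -/
theorem not_pseudoOrbitTransitionTimed (q : ℕ) : ¬ PseudoOrbitTransitionTimed q :=
  fun h => not_pseudoOrbitTransition q h.untimed

/-- **Every member is a witness below `q = 3000`**: for `q ≤ 2999` the refuting dud lives on EVERY
member `3000 log K ≤ M` (not only on Tao's `M = K¹⁰`), because `2K^q ≤ K³⁰⁰⁰ ≤ e^M`: the budget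
`ε²/K^q` admits, for every such `(K, M, ε)`, a pseudo-orbit from (5.6) on `[0,2]` in the `2`-ball
that has NOT fired at time `2`. [cite: Tao2016AveragedNS, §5.5 Theorem 5.3] -/
theorem exists_dud_below_poly_budget_all_members {K M ε : ℝ} {q : ℕ} (hq : q ≤ 2999)
    (hK : 2 * 20 ^ 42 * (Nat.factorial 42 : ℝ) + 16 ≤ K) (hML : 3000 * Real.log K ≤ M) :
    ∃ (Y : ℝ → Fin 5 → ℝ) (δ : ℝ), 0 ≤ δ ∧ IsPseudoOrbit (delayCircuitWith K M ε) δ 2 2 Y ∧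
      Y 0 = delayInit ∧ 0 + δ * 2 ≤ ε ^ 2 / K ^ q ∧ Y 2 4 = 0 := by
  have hB : (0 : ℝ) ≤ 2 * 20 ^ 42 * (Nat.factorial 42 : ℝ) := by positivity
  have hK16 : (16 : ℝ) ≤ K := by linarith
  have hKpos : (0 : ℝ) < K := by linarith
  have hK1 : (1 : ℝ) ≤ K := by linarith
  have hKqpos : (0 : ℝ) < K ^ q := pow_pos hKpos q
  refine ⟨seedFreeOrbit ε, ε ^ 2 * Real.exp (-M), by positivity,
    seedFreeOrbit_isPseudoOrbit_with K M ε 2 (by norm_num), seedFreeOrbit_zero ε, ?_,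
    seedFreeOrbit_output ε 2⟩
  -- `2·K^q ≤ K^{q+1} ≤ K^3000 = e^{3000 log K} ≤ e^M`
  have hKM : 2 * K ^ q ≤ Real.exp M := by
    have hlog : Real.exp (3000 * Real.log K) = K ^ (3000 : ℕ) := by
      rw [show (3000 : ℝ) * Real.log K = Real.log K * ((3000 : ℕ) : ℝ) by push_cast; ring,
        ← Real.rpow_def_of_pos hKpos, Real.rpow_natCast]
    calc 2 * K ^ q ≤ K * K ^ q := by gcongr; linarith
      _ = K ^ (q + 1) := by ring
      _ ≤ K ^ (3000 : ℕ) := pow_le_pow_right₀ hK1 (by omega)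
      _ = Real.exp (3000 * Real.log K) := hlog.symm
      _ ≤ Real.exp M := Real.exp_le_exp.2 hML
  have h2 : 2 * Real.exp (-M) ≤ 1 / K ^ q := by
    rw [Real.exp_neg, le_div_iff₀ hKqpos]
    calc 2 * (Real.exp M)⁻¹ * K ^ q = 2 * K ^ q / Real.exp M := by ring
      _ ≤ 1 := by rw [div_le_one (Real.exp_pos _)]; exact hKM
  calc 0 + ε ^ 2 * Real.exp (-M) * 2 = ε ^ 2 * (2 * Real.exp (-M)) := by ring
    _ ≤ ε ^ 2 * (1 / K ^ q) := by gcongr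
    _ = ε ^ 2 / K ^ q := by ring

/-! ## §4. The necessary budget on the logarithmic retuning is a power of `K` -/

/-- On the logarithmic retuning `M = p·log K` the dud's integrated seed over the uniform cycle
`[0,2]` is the POWER `2ε²/K^p` of `K`. [cite: Tao2016AveragedNS, §5.5 (5.5)] -/
theorem seed_budget_log {K ε : ℝ} {p : ℕ} (hK : 0 < K) :
    ε ^ 2 * Real.exp (-(p * Real.log K)) * 2 = 2 * ε ^ 2 / K ^ p := by
  have h : Real.exp (-(p * Real.log K)) = (K ^ p)⁻¹ := by
    rw [Real.exp_neg, show (p : ℝ) * Real.log K = Real.log K * p by ring,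
      ← Real.rpow_def_of_pos hK, Real.rpow_natCast]
  rw [h]
  ring

/-- **The log-retuned necessary budget.** For the member `M = p log K` (any `K > 0`, any `ε`, any
`R ≥ 1`, any tolerance `θ < 1`): a forcing budget that guarantees loading of the output at the cycle
time `2` from Tao's datum is `< 2ε²/K^p` — polynomial in `K`, a factor `2K^{p-10}` above the proved
kick tolerance `kickToleranceWith = ε²K^{10-p}` of the same member (`kickToleranceWith_log`).
[cite: Tao2016AveragedNS, §5.5 Theorem 5.3] -/
theorem budget_lt_poly_of_firing_guarantee_log {K ε B θ : ℝ} {p : ℕ} {R : ℝ≥0} (hR : 1 ≤ R)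
    (hK : 0 < K) (hθ : θ < 1)
    (h : ∀ (Y : ℝ → Fin 5 → ℝ) (δ δ₀ : ℝ), 0 ≤ δ → 0 ≤ δ₀ →
      IsPseudoOrbit (delayCircuitWith K (p * Real.log K) ε) δ R 2 Y → ‖Y 0 - delayInit‖ ≤ δ₀ →
      δ₀ + δ * 2 ≤ B → |Y 2 4 - 1| ≤ θ) :
    B < 2 * ε ^ 2 / K ^ p := by
  rw [← seed_budget_log hK]
  exact budget_lt_seed_of_firing_guarantee hR hθ h

end Literature.Analysis.FluidPDE.Tao2016AveragedNS
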